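import Mathlib
import Summits.MatrixMultiplication.MatrixMultiplication.Theorems.FidelityWitnessesFidelityGapThreeSeventeenStubBorelNormalFormOps

/-!
# Borel normal form, part 8: commutation relations of the Borel operators

Support file for `stub_borelNormalForm` (line `symbolic-square-border-apolarity` of
`FidelityWitnesses.FidelityGapThreeSeventeen`).  Rows commute with columns, rows (columns) on different
slots commute, and on one slot they satisfy the `𝔤𝔩₃` relations
`[R_{pq}, R_{p'q'}] = [p = q'] R_{p'q} - [p' = q] R_{pq'}` (checked on variables through the extension
principle for derivations).  Consequently operators of different factors commute (`opL_comm`) and each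
factor satisfies `[E_{pq}, E_{p'q'}] = [p = q'] E_{p'q} - [p' = q] E_{pq'}` (`opL_bracket`) — the normal
series bookkeeping of the unipotent steps.  PROVED.
-/

noncomputable section

namespace Summit.MatrixMultiplication.MatrixMultiplication.Theorems.SymbolicSquare

-- single-conjunct summit: the `Summit.<S>.<P>` prefix repeats `MatrixMultiplication` by design (D-0017)
set_option linter.dupNamespace false

open scoped BigOperators Polynomial
open Polynomial

/-! ## Commutation relations of the operators -/

section Brackets

open BorelLimit

/-- **Rows commute with columns** (on any slots). -/
theorem rowOp_comm_colOp (s p q s' p' q' : Fin 3) :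
    rowOp s p q ∘ₗ colOp s' p' q' = colOp s' p' q' ∘ₗ rowOp s p q := by
  rw [← sub_eq_zero]
  refine ext_of_leibniz (leibniz_bracket (rowOp_leibniz s p q) (colOp_leibniz s' p' q')) leibniz_zero' ?_
  rintro ⟨s'', i, j⟩
  simp only [LinearMap.sub_apply, LinearMap.comp_apply, LinearMap.zero_apply, rowOp_X, colOp_X]
  split_ifs <;> simp_all [rowOp_X, colOp_X]

/-- Rows on different slots commute. -/
theorem rowOp_comm_rowOp (s s' : Fin 3) (h : s ≠ s') (p q p' q' : Fin 3) :
    rowOp s p q ∘ₗ rowOp s' p' q' = rowOp s' p' q' ∘ₗ rowOp s p q := by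
  rw [← sub_eq_zero]
  refine ext_of_leibniz (leibniz_bracket (rowOp_leibniz s p q) (rowOp_leibniz s' p' q')) leibniz_zero' ?_
  rintro ⟨s'', i, j⟩
  simp only [LinearMap.sub_apply, LinearMap.comp_apply, LinearMap.zero_apply, rowOp_X]
  split_ifs <;> simp_all [rowOp_X]
  all_goals exact fun h' => absurd h'.symm h

/-- Columns on different slots commute. -/
theorem colOp_comm_colOp (s s' : Fin 3) (h : s ≠ s') (p q p' q' : Fin 3) :
    colOp s p q ∘ₗ colOp s' p' q' = colOp s' p' q' ∘ₗ colOp s p q := by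
  rw [← sub_eq_zero]
  refine ext_of_leibniz (leibniz_bracket (colOp_leibniz s p q) (colOp_leibniz s' p' q')) leibniz_zero' ?_
  rintro ⟨s'', i, j⟩
  simp only [LinearMap.sub_apply, LinearMap.comp_apply, LinearMap.zero_apply, colOp_X]
  split_ifs <;> simp_all [colOp_X]
  all_goals exact fun h' => absurd h'.symm h

/-- **`𝔤𝔩₃` relations for rows** on one slot: `[R_{pq}, R_{p'q'}] = [p = q'] R_{p'q} - [p' = q] R_{pq'}`. -/
theorem rowOp_bracket (s p q p' q' : Fin 3) :
    rowOp s p q ∘ₗ rowOp s p' q' - rowOp s p' q' ∘ₗ rowOp s p q =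
      (if p = q' then (1 : ℂ) else 0) • rowOp s p' q - (if p' = q then (1 : ℂ) else 0) • rowOp s p q' := by
  refine ext_of_leibniz (leibniz_bracket (rowOp_leibniz s p q) (rowOp_leibniz s p' q'))
    (leibniz_sub' (leibniz_smul' (rowOp_leibniz s p' q) _) (leibniz_smul' (rowOp_leibniz s p q') _)) ?_
  rintro ⟨s'', i, j⟩
  simp only [LinearMap.sub_apply, LinearMap.comp_apply, LinearMap.smul_apply, rowOp_X]
  split_ifs <;> simp_all [rowOp_X] <;> aesop

/-- **`𝔤𝔩₃` relations for columns** on one slot: `[C_{pq}, C_{p'q'}] = [p = q'] C_{p'q} - [p' = q] C_{pq'}`. -/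
theorem colOp_bracket (s p q p' q' : Fin 3) :
    colOp s p q ∘ₗ colOp s p' q' - colOp s p' q' ∘ₗ colOp s p q =
      (if p = q' then (1 : ℂ) else 0) • colOp s p' q - (if p' = q then (1 : ℂ) else 0) • colOp s p q' := by
  refine ext_of_leibniz (leibniz_bracket (colOp_leibniz s p q) (colOp_leibniz s p' q'))
    (leibniz_sub' (leibniz_smul' (colOp_leibniz s p' q) _) (leibniz_smul' (colOp_leibniz s p q') _)) ?_
  rintro ⟨s'', i, j⟩
  simp only [LinearMap.sub_apply, LinearMap.comp_apply, LinearMap.smul_apply, colOp_X]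
  split_ifs <;> simp_all [colOp_X] <;> aesop

/-- **`U`- and `V`-operators commute.** -/
theorem opL_comm01 (p q p' q' : Fin 3) : opL 0 p q ∘ₗ opL 1 p' q' = opL 1 p' q' ∘ₗ opL 0 p q := by
  have h1 := rowOp_comm_colOp 0 p q 0 q' p'
  have h2 := rowOp_comm_rowOp 0 1 (by decide) p q p' q'
  have h3 := rowOp_comm_colOp 2 q p 0 q' p'
  have h4 := rowOp_comm_rowOp 2 1 (by decide) q p p' q'
  rw [opL0_eq, opL1_eq]
  simp only [LinearMap.comp_add, LinearMap.add_comp, LinearMap.comp_sub, LinearMap.sub_comp, LinearMap.comp_neg,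
    LinearMap.neg_comp, h1, h2, h3, h4]
  abel

/-- **`U`- and `W`-operators commute.** -/
theorem opL_comm02 (p q p' q' : Fin 3) : opL 0 p q ∘ₗ opL 2 p' q' = opL 2 p' q' ∘ₗ opL 0 p q := by
  have h1 := rowOp_comm_colOp 0 p q 1 q' p'
  have h2 := rowOp_comm_colOp 0 p q 2 p' q'
  have h3 := rowOp_comm_colOp 2 q p 1 q' p'
  have h4 := rowOp_comm_colOp 2 q p 2 p' q'
  rw [opL0_eq, opL2_eq]
  simp only [LinearMap.comp_add, LinearMap.add_comp, LinearMap.comp_sub, LinearMap.sub_comp, LinearMap.comp_neg,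
    LinearMap.neg_comp, h1, h2, h3, h4]
  abel

/-- **`V`- and `W`-operators commute.** -/
theorem opL_comm12 (p q p' q' : Fin 3) : opL 1 p q ∘ₗ opL 2 p' q' = opL 2 p' q' ∘ₗ opL 1 p q := by
  have h1 := colOp_comm_colOp 0 1 (by decide) q p q' p'
  have h2 := colOp_comm_colOp 0 2 (by decide) q p p' q'
  have h3 := rowOp_comm_colOp 1 p q 1 q' p'
  have h4 := rowOp_comm_colOp 1 p q 2 p' q'
  rw [opL1_eq, opL2_eq]
  simp only [LinearMap.comp_add, LinearMap.add_comp, LinearMap.comp_neg, LinearMap.neg_comp, h1, h2, h3, h4]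
  abel

/-- Four-branch evaluation of the Kronecker scalars `[p = q']`, `[p' = q]` and their mirror images. -/
theorem ite_mirror_cases {M : Type*} [AddCommGroup M] [Module ℂ M] (p q p' q' : Fin 3) (A B C D : M)
    (h : ∀ (α β : ℂ), α • A - β • B + (β • C - α • D) = α • (A - D) - β • (B - C)) :
    (if p = q' then (1 : ℂ) else 0) • A - (if p' = q then (1 : ℂ) else 0) • B +
      ((if q = p' then (1 : ℂ) else 0) • C - (if q' = p then (1 : ℂ) else 0) • D) =
    (if p = q' then (1 : ℂ) else 0) • (A - D) - (if p' = q then (1 : ℂ) else 0) • (B - C) := by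
  have e1 : (if q = p' then (1 : ℂ) else 0) = (if p' = q then (1 : ℂ) else 0) := by
    by_cases hh : p' = q
    · rw [if_pos hh, if_pos hh.symm]
    · rw [if_neg hh, if_neg (fun h' => hh h'.symm)]
  have e2 : (if q' = p then (1 : ℂ) else 0) = (if p = q' then (1 : ℂ) else 0) := by
    by_cases hh : p = q'
    · rw [if_pos hh, if_pos hh.symm]
    · rw [if_neg hh, if_neg (fun h' => hh h'.symm)]
  rw [e1, e2]
  exact h _ _

/-- `𝔤𝔩₃` relations in the `U`-factor. -/
theorem opL0_bracket (p q p' q' : Fin 3) :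
    opL 0 p q ∘ₗ opL 0 p' q' - opL 0 p' q' ∘ₗ opL 0 p q =
      (if p = q' then (1 : ℂ) else 0) • opL 0 p' q - (if p' = q then (1 : ℂ) else 0) • opL 0 p q' := by
  have h1 := rowOp_bracket 0 p q p' q'
  have h2 := rowOp_comm_rowOp 0 2 (by decide) p q q' p'
  have h3 := rowOp_comm_rowOp 0 2 (by decide) p' q' q p
  have h4 := rowOp_bracket 2 q p q' p'
  rw [opL0_eq p q, opL0_eq p' q', opL0_eq p' q, opL0_eq p q']
  have e : (rowOp 0 p q - rowOp 2 q p) ∘ₗ (rowOp 0 p' q' - rowOp 2 q' p') -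
      (rowOp 0 p' q' - rowOp 2 q' p') ∘ₗ (rowOp 0 p q - rowOp 2 q p) =
      (rowOp 0 p q ∘ₗ rowOp 0 p' q' - rowOp 0 p' q' ∘ₗ rowOp 0 p q) +
        (rowOp 2 q p ∘ₗ rowOp 2 q' p' - rowOp 2 q' p' ∘ₗ rowOp 2 q p) +
        (rowOp 2 q' p' ∘ₗ rowOp 0 p q - rowOp 0 p q ∘ₗ rowOp 2 q' p') +
        (rowOp 0 p' q' ∘ₗ rowOp 2 q p - rowOp 2 q p ∘ₗ rowOp 0 p' q') := by
    simp only [LinearMap.comp_sub, LinearMap.sub_comp]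
    abel
  rw [e, h1, h4, h2, h3, sub_self, sub_self, add_zero, add_zero]
  exact ite_mirror_cases p q p' q' _ _ _ _ fun α β => by rw [smul_sub, smul_sub]; abel

/-- `𝔤𝔩₃` relations in the `V`-factor. -/
theorem opL1_bracket (p q p' q' : Fin 3) :
    opL 1 p q ∘ₗ opL 1 p' q' - opL 1 p' q' ∘ₗ opL 1 p q =
      (if p = q' then (1 : ℂ) else 0) • opL 1 p' q - (if p' = q then (1 : ℂ) else 0) • opL 1 p q' := by
  have h1 := colOp_bracket 0 q p q' p'
  have h2 := rowOp_comm_colOp 1 p q 0 q' p'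
  have h3 := rowOp_comm_colOp 1 p' q' 0 q p
  have h4 := rowOp_bracket 1 p q p' q'
  rw [opL1_eq p q, opL1_eq p' q', opL1_eq p' q, opL1_eq p q']
  have e : (-colOp 0 q p + rowOp 1 p q) ∘ₗ (-colOp 0 q' p' + rowOp 1 p' q') -
      (-colOp 0 q' p' + rowOp 1 p' q') ∘ₗ (-colOp 0 q p + rowOp 1 p q) =
      (rowOp 1 p q ∘ₗ rowOp 1 p' q' - rowOp 1 p' q' ∘ₗ rowOp 1 p q) +
        (colOp 0 q p ∘ₗ colOp 0 q' p' - colOp 0 q' p' ∘ₗ colOp 0 q p) +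
        (colOp 0 q' p' ∘ₗ rowOp 1 p q - rowOp 1 p q ∘ₗ colOp 0 q' p') +
        (rowOp 1 p' q' ∘ₗ colOp 0 q p - colOp 0 q p ∘ₗ rowOp 1 p' q') := by
    simp only [LinearMap.comp_add, LinearMap.add_comp, LinearMap.comp_neg, LinearMap.neg_comp]
    abel
  rw [e, h1, h4, h2, h3, sub_self, sub_self, add_zero, add_zero, neg_add_eq_sub, neg_add_eq_sub]
  exact ite_mirror_cases p q p' q' _ _ _ _ fun α β => by rw [smul_sub, smul_sub]; abel

/-- `𝔤𝔩₃` relations in the `W`-factor. -/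
theorem opL2_bracket (p q p' q' : Fin 3) :
    opL 2 p q ∘ₗ opL 2 p' q' - opL 2 p' q' ∘ₗ opL 2 p q =
      (if p = q' then (1 : ℂ) else 0) • opL 2 p' q - (if p' = q then (1 : ℂ) else 0) • opL 2 p q' := by
  have h1 := colOp_bracket 1 q p q' p'
  have h2 := colOp_comm_colOp 1 2 (by decide) q p p' q'
  have h3 := colOp_comm_colOp 1 2 (by decide) q' p' p q
  have h4 := colOp_bracket 2 p q p' q'
  rw [opL2_eq p q, opL2_eq p' q', opL2_eq p' q, opL2_eq p q']
  have e : (-colOp 1 q p + colOp 2 p q) ∘ₗ (-colOp 1 q' p' + colOp 2 p' q') -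
      (-colOp 1 q' p' + colOp 2 p' q') ∘ₗ (-colOp 1 q p + colOp 2 p q) =
      (colOp 2 p q ∘ₗ colOp 2 p' q' - colOp 2 p' q' ∘ₗ colOp 2 p q) +
        (colOp 1 q p ∘ₗ colOp 1 q' p' - colOp 1 q' p' ∘ₗ colOp 1 q p) +
        (colOp 1 q' p' ∘ₗ colOp 2 p q - colOp 2 p q ∘ₗ colOp 1 q' p') +
        (colOp 2 p' q' ∘ₗ colOp 1 q p - colOp 1 q p ∘ₗ colOp 2 p' q') := by
    simp only [LinearMap.comp_add, LinearMap.add_comp, LinearMap.comp_neg, LinearMap.neg_comp]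
    abel
  rw [e, h1, h4, ← h2, ← h3, sub_self, sub_self, add_zero, add_zero, neg_add_eq_sub, neg_add_eq_sub]
  exact ite_mirror_cases p q p' q' _ _ _ _ fun α β => by rw [smul_sub, smul_sub]; abel

/-- **`𝔤𝔩₃` relations inside each factor**:
`[E_{pq}, E_{p'q'}] = [p = q'] E_{p'q} - [p' = q] E_{pq'}` for the operators `opL X`. -/
theorem opL_bracket (X p q p' q' : Fin 3) :
    opL X p q ∘ₗ opL X p' q' - opL X p' q' ∘ₗ opL X p q =
      (if p = q' then (1 : ℂ) else 0) • opL X p' q - (if p' = q then (1 : ℂ) else 0) • opL X p q' := by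
  have hX : X = 0 ∨ X = 1 ∨ X = 2 := by fin_cases X <;> simp
  rcases hX with rfl | rfl | rfl
  · exact opL0_bracket p q p' q'
  · exact opL1_bracket p q p' q'
  · exact opL2_bracket p q p' q'

/-- **Operators of different factors commute.** -/
theorem opL_comm (X Y : Fin 3) (hXY : X ≠ Y) (p q p' q' : Fin 3) :
    opL X p q ∘ₗ opL Y p' q' = opL Y p' q' ∘ₗ opL X p q := by
  have hX : X = 0 ∨ X = 1 ∨ X = 2 := by fin_cases X <;> simp
  have hY : Y = 0 ∨ Y = 1 ∨ Y = 2 := by fin_cases Y <;> simp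
  rcases hX with rfl | rfl | rfl <;> rcases hY with rfl | rfl | rfl
  · exact absurd rfl hXY
  · exact opL_comm01 p q p' q'
  · exact opL_comm02 p q p' q'
  · exact (opL_comm01 p' q' p q).symm
  · exact absurd rfl hXY
  · exact opL_comm12 p q p' q'
  · exact (opL_comm02 p' q' p q).symm
  · exact (opL_comm12 p' q' p q).symm
  · exact absurd rfl hXY

end Brackets


/-- **Part 8 of `stub_borelNormalForm` (registered helper stub): operators of different factors commute.** -/
theorem stub_borelNormalForm_brackets : ∀ (X Y : Fin 3), X ≠ Y → ∀ (p q p' q' : Fin 3),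
    opL X p q ∘ₗ opL Y p' q' = opL Y p' q' ∘ₗ opL X p q :=
  fun X Y hXY p q p' q' => opL_comm X Y hXY p q p' q'

end Summit.MatrixMultiplication.MatrixMultiplication.Theorems.SymbolicSquare

end
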